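import Summits.QuantumFields.YangMills.Theorems.BalabanUVNodesN15BackgroundSiteOfLetters
import Summits.QuantumFields.YangMills.Theorems.BalabanUVNodesN15SiteReadout
import Summits.QuantumFields.YangMills.Theorems.BalabanUVNodesN15BackgroundVWordsCoarse
import HarnessLib

/-!
# Route «BalabanUVNodes» (K4 «SpineRates»), node N15 = NE2 — THE SITE-KERNEL LAYER WITH THE BACKGROUND LIVE, V: `T4EtaRate.NE2PlusSite` BY NAME on g3's gauge
# paired instances — the dressed site kernel `[Q′(U′U)G′²(U′U)Q′*(U′U)]⁻¹` with the (3.60)-shaped full perturbation `V′(A′)` LIVE (gauge field the datum, coarse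
# `V′₁` at the mean field's own triple — the SAME instances and perturbation as F15's `ne2PlusOperator_vWGC`), for ANY block-local averaging species

Cell `pub-ymgap`, seat `pub-ymgap-dag-n15-c` (generation g5; R134 ACCELERATION SEAT, strategy s1; HUMAN RULING D-0062; chair R424 venue; `bears_on: R4∕N15`).  Filed
`--supports stmt-QuantumFields-20292 --as helper` (K3⁗; count-neutral).  Imports this seat's S4 `…N15BackgroundSiteOfLetters` (`hasMaj_idef_dressedSite`, `dressedOp`,
`xAmp`∕`cAmp`∕`siteAmp`), S3 `…N15SiteReadout` (`siteKernelOf`, `etaRateIneqSite_opGeo_of_hasMaj_rateWeight`) and g4's F14 `…N15BackgroundVWordsCoarse`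
(`vWC_letters_of_gauge`, `vWPert`, `vWR`, `gVWc35`; through it g3's `v1GaugeBg`∕`v1GaugeInstance`, `v1fieldsOfGauge`, `gavgM`, `v1coefC`∕`v1coefA`) BY NAME; nothing
in the tree is modified.

WHAT THIS FILE IS.  §1 the smallness arithmetic (`cLin`, `cAmp_le_lin`, `siteAmp_nonneg`): the site Neumann guard `β_W·cAmp·c_r² ≤ ½` follows from `a₀ ≤ a₂ :=
(2β_W·cLin·c_r² + 1)⁻¹`.  §2 ★ `hasMaj_idef_vWSiteC` — PER CONFIGURATION: one gauge field `A′` with the C² letters (3.35) at `c`, the hypotheses of F14's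
`vWC_letters_of_gauge` (commuting unit shifts, `C_π`-step-connected fibres, block-translation law, species words `W, W′`), ANY averaging species `F₂, F₂*` (coarse) ∕
`F₂′, F₂*′` (fine) with block-local letters at `c_F·(2c′Mα₀)` and fits at `·θ`, the `U ≡ 1` layer `G, D_μ` and the `U ≡ 1` site kernels `W_s, W_s′` ⟹ the η-defect
of the dressed site kernels is `≤ siteAmp·θ·e^{−(δ−5σ)d}` (S4 at `R = gVWc35(2c′)·a₀`, `r = o₀ = c_F(2c′)a₀`).  §3 `vWSiteOpsC`, `vWGCSiteKernel` (the site-kernel family on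
g3's `v1GaugeInstance`: at the fine configuration `A′` the η-difference of the fine dressed site kernel at `A′` and the coarse one at `Ā = gavgM π A′`), ★★
**`ne2PlusSite_vWGC`** — `NE2PlusSite 4 p c₃₅` BY NAME for that family, constants chosen inside (`M₅ = 1`, `δ_site = δ − 5σ`, `a₀ = min a₁ a₂`, `C = siteAmp + 1`).
With F15∕F16 this puts TWO of the three conjuncts of `YMDAG.UVSplit.N15At` on ONE background-live family with every perturbation∕species input a letter
hypothesis dischargeable from (3.35) — the sequel inhabits both at the vector piece ⊗ 1_𝔤.

HONEST FRAMING ∕ LIMITS.  The `U ≡ 1` layer (`G, D_μ`, their η-defects) and the `U ≡ 1` SITE KERNELS `W_s, W_s′` (inverse of `QG²Q*` with a decaying majorant — the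
printed Thm 3.2 (3.48) object at `U ≡ 1`, [B5]∕King turf) are DISPLAYED hypotheses; the averaging species are letters (g4 F7∕F9 construct the print's at `U ≡ 1`);
transport of configurations = fibrewise mean (linearised (C3)); single-scale unit torus ∕ unit site lattice (`len ≡ 1`).  Nothing about Bałaban's `G(U)`, `Q(U)` is
asserted; NE2⁺ NOT PRINTED, NOT proved; count-neutral (typed 28∕28; discharged count unchanged); N15 NOT discharged; one finite T⁴ at fixed ε — NOT infinite volume,
NOT OS on ℝ⁴, NOT a mass gap, NOT Clay.
-/

noncomputable section

open scoped BigOperators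

namespace Summit.QuantumFields.YangMills.BalabanUVNodes.N15.SiteLayer

open Literature.MathematicalPhysics.QuantumFieldTheory.Balaban1983to89
open Literature.MathematicalPhysics.QuantumFieldTheory.Balaban1983to89.B11SectG (BlockNorm HasMaj RowSum)
open Literature.MathematicalPhysics.QuantumFieldTheory.Balaban1983to89.T4EtaRate (PairedInstance EtaRateIneqSite NE2PlusSite rateFactor)
open Literature.MathematicalPhysics.QuantumFieldTheory.Balaban1983to89.T4EtaRateDefect (idef rateWeight)
open Literature.MathematicalPhysics.QuantumFieldTheory.Balaban1983to89.T4EtaRateCoeffDefect (pull diagK diagK_mono fibre)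
open Literature.MathematicalPhysics.QuantumFieldTheory.Balaban1983to89.B6RandomWalk (Triangle254)
open Literature.MathematicalPhysics.QuantumFieldTheory.Balaban1983to89.B9SectDSup (inv_one_sub_le_two)
open Summit.QuantumFields.YangMills.BalabanUVNodes.N15.OperatorReadout (opGeo opGeo_len)
open Summit.QuantumFields.YangMills.BalabanUVNodes.N15.MatrixSpecies (liftMap liftBlk basisConst basisConst_nonneg)
open Summit.QuantumFields.YangMills.BalabanUVNodes.N15.BackgroundLayer (blkPair liftPair bgConst bgConst_nonneg vWPert vWR gVWc35 le_gVWc35 vWC_letters_of_gauge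
  v1coefC v1coefA v1fieldsOfGauge gavgM v1GaugeBg v1GaugeInstance)

/-! ## §1 Smallness arithmetic -/

section Small

/-- THE LINEAR BOUND of the (3.66) amplitude in `a₀`: `cAmp(β, Ka₀, c_r, r_Ka₀) ≤ a₀·cLin(β, K, c_r, r_K)` for `a₀ ≤ 1` under the operator guard. [folklore] -/
def cLin (β K cr rK : ℝ) : ℝ :=
  (rK * ((2 * β) * (2 * β) * (1 + rK * 1)) + (2 * β) * (2 * β) * rK + ((2 * β) + β) * (β * (K * (2 * β)) * cr)) * cr

/-- `cLin ≥ 0`. [folklore] -/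
theorem cLin_nonneg {β K cr rK : ℝ} (hβ : 0 ≤ β) (hK : 0 ≤ K) (hcr : 0 ≤ cr) (hrK : 0 ≤ rK) : 0 ≤ cLin β K cr rK := by
  unfold cLin; positivity

/-- **`cAmp ≤ a₀·cLin`** for `0 ≤ a₀ ≤ 1` and `β(Ka₀)c_r ≤ ½` (so that `xAmp ≤ 2β`). [folklore] -/
theorem cAmp_le_lin {β K cr rK a₀ : ℝ} (hβ : 0 ≤ β) (hK : 0 ≤ K) (hcr : 0 ≤ cr) (hrK : 0 ≤ rK) (ha₀ : 0 ≤ a₀) (ha₀1 : a₀ ≤ 1)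
    (hq : β * (K * a₀) * cr ≤ 1 / 2) : cAmp β (K * a₀) cr (rK * a₀) ≤ a₀ * cLin β K cr rK := by
  have hqlt : β * (K * a₀) * cr < 1 := by linarith
  have hx0 : 0 ≤ xAmp β (K * a₀) cr := xAmp_nonneg hβ hqlt
  have hx : xAmp β (K * a₀) cr ≤ 2 * β := by
    unfold xAmp
    calc β * (1 - β * (K * a₀) * cr)⁻¹ ≤ β * 2 := mul_le_mul_of_nonneg_left (inv_one_sub_le_two hq) hβ
      _ = 2 * β := by ring
  set x := xAmp β (K * a₀) cr with hxdef
  have h1 : rK * a₀ * (x * x * (1 + rK * a₀)) ≤ rK * a₀ * ((2 * β) * (2 * β) * (1 + rK * 1)) := by gcongr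
  have h2 : x * x * (rK * a₀) ≤ (2 * β) * (2 * β) * (rK * a₀) := by gcongr
  have h3 : (x + β) * (β * (K * a₀ * x) * cr) ≤ ((2 * β) + β) * (β * (K * a₀ * (2 * β)) * cr) := by gcongr
  unfold cAmp
  rw [← hxdef]
  calc (rK * a₀ * (x * x * (1 + rK * a₀)) + x * x * (rK * a₀) + (x + β) * (β * (K * a₀ * x) * cr)) * cr
      ≤ (rK * a₀ * ((2 * β) * (2 * β) * (1 + rK * 1)) + (2 * β) * (2 * β) * (rK * a₀) + ((2 * β) + β) * (β * (K * a₀ * (2 * β)) * cr)) * cr := by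
        gcongr
    _ = a₀ * cLin β K cr rK := by unfold cLin; ring

/-- `siteAmp ≥ 0` below the two thresholds. [folklore] -/
theorem siteAmp_nonneg {β R cr r m₀ K a₀ o₀ βW : ℝ} (hβ : 0 ≤ β) (hcr : 0 ≤ cr) (hr : 0 ≤ r) (hm₀ : 0 ≤ m₀) (hK : 0 ≤ K) (ha₀ : 0 ≤ a₀)
    (ho₀ : 0 ≤ o₀) (hβW : 0 ≤ βW) (hq1 : β * R * cr < 1) (hq2 : βW * cAmp β R cr r * cr * cr < 1) : 0 ≤ siteAmp β R cr r m₀ K a₀ o₀ βW := by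
  have hx := xAmp_nonneg hβ hq1
  have hb := bgConst_nonneg hβ hcr hm₀ hK ha₀
  have hA : 0 ≤ βW * (1 - βW * cAmp β R cr r * cr * cr)⁻¹ := mul_nonneg hβW (inv_nonneg.2 (by linarith))
  unfold siteAmp; positivity

/-- **THE TWO THRESHOLDS AT ONCE**: for `K ≥ 2c′ > 0`, `P, β, c_r, β_W ≥ 0` there is `a₀ ∈ (0, 1]` with `β(Ka₀)c_r ≤ ½`, `2(2c′)a₀ ≤ 1` (F15's operator guard) and
`β_W(a₀P)c_r² ≤ ½` (the site guard): `a₀ = min (2K(βc_r + 1))⁻¹ (2β_WPc_r² + 1)⁻¹`. [folklore] -/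
theorem site_thresholds {β cr K P βW c' : ℝ} (hβ : 0 ≤ β) (hcr : 0 ≤ cr) (hK : 0 < K) (hcK : 2 * c' ≤ K) (hc' : 0 < c') (hP : 0 ≤ P) (hβW : 0 ≤ βW) :
    ∃ a₀ : ℝ, 0 < a₀ ∧ a₀ ≤ 1 ∧ β * (K * a₀) * cr ≤ 1 / 2 ∧ 2 * (2 * c' * a₀) ≤ 1 ∧ βW * (a₀ * P) * cr * cr ≤ 1 / 2 := by
  set a₁ : ℝ := (2 * K * (β * cr + 1))⁻¹ with ha₁_def
  have ha₁ : 0 < a₁ := inv_pos.2 (by positivity)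
  set a₂ : ℝ := (2 * βW * P * cr * cr + 1)⁻¹ with ha₂_def
  have hden₂ : 0 < 2 * βW * P * cr * cr + 1 := by positivity
  have ha₂ : 0 < a₂ := inv_pos.2 hden₂
  have ha₂1 : a₂ ≤ 1 := by
    rw [ha₂_def]
    refine inv_le_one_of_one_le₀ ?_
    have : 0 ≤ 2 * βW * P * cr * cr := by positivity
    linarith
  have hq₁ : β * (K * a₁) * cr ≤ 1 / 2 := by
    have h1 : β * (K * a₁) * cr = (β * cr) * (K * a₁) := by ring
    have h2 : K * a₁ = (2 * (β * cr + 1))⁻¹ := by rw [ha₁_def]; field_simp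
    rw [h1, h2, ← div_eq_mul_inv, div_le_iff₀ (by positivity)]
    nlinarith [mul_nonneg hβ hcr]
  have ha₁1 : 2 * (2 * c' * a₁) ≤ 1 := by
    have h2 : 2 * (2 * c' * a₁) = (2 * c') / (K * (β * cr + 1)) := by rw [ha₁_def]; field_simp
    rw [h2, div_le_one (by positivity)]
    nlinarith [mul_nonneg hβ hcr, hK]
  have hq₂ : βW * (a₂ * P) * cr * cr ≤ 1 / 2 := by
    have : βW * (a₂ * P) * cr * cr = (βW * P * cr * cr) / (2 * βW * P * cr * cr + 1) := by rw [ha₂_def]; field_simp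
    rw [this, div_le_iff₀ hden₂]
    have : 0 ≤ βW * P * cr * cr := by positivity
    linarith
  refine ⟨min a₁ a₂, lt_min ha₁ ha₂, (min_le_right _ _).trans ha₂1, ?_, ?_, ?_⟩
  · have : β * (K * min a₁ a₂) * cr ≤ β * (K * a₁) * cr :=
      mul_le_mul_of_nonneg_right (mul_le_mul_of_nonneg_left (mul_le_mul_of_nonneg_left (min_le_left _ _) hK.le) hβ) hcr
    exact this.trans hq₁
  · have : 2 * c' * min a₁ a₂ ≤ 2 * c' * a₁ := mul_le_mul_of_nonneg_left (min_le_left _ _) (by positivity)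
    linarith
  · have : βW * (min a₁ a₂ * P) * cr * cr ≤ βW * (a₂ * P) * cr * cr :=
      mul_le_mul_of_nonneg_right (mul_le_mul_of_nonneg_right (mul_le_mul_of_nonneg_left
        (mul_le_mul_of_nonneg_right (min_le_right _ _) hP) hβW) hcr) hcr
    exact this.trans hq₂

end Small

/-! ## §2 Per configuration: the dressed site kernels' η-defect with the full perturbation live -/

section Config

variable {X X' Y J ι : Type} [Fintype X] [Fintype X'] [Fintype Y] [Fintype J] [Fintype ι] [DecidableEq X] [DecidableEq X'] [DecidableEq Y] [DecidableEq J]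
  [DecidableEq ι] {𝔄 : Type} [NormedRing 𝔄] [NormedAlgebra ℝ 𝔄] [CompleteSpace 𝔄] (e : 𝔄 ≃L[ℝ] (ι → ℝ)) {g : B6.Geometry} (blk : X → g.Site)
  (blkY : Y → g.Site) (q : X × ι → Y) (π : X' → X)
variable {G : (X × ι → ℝ) →ₗ[ℝ] (X × ι → ℝ)} {D : J ⊕ J → (X × ι → ℝ) →ₗ[ℝ] (X × ι → ℝ)} {G' : (X' × ι → ℝ) →ₗ[ℝ] (X' × ι → ℝ)}
  {D' : J ⊕ J → (X' × ι → ℝ) →ₗ[ℝ] (X' × ι → ℝ)}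

/-- **THE η-DEFECT OF THE DRESSED SITE KERNELS WITH THE FULL PERTURBATION LIVE, PER CONFIGURATION.**  Data of F14's `vWC_letters_of_gauge` (one gauge field `A′` with
(3.35) at `c`, commuting shifts, `C_π`-step-connected fibres, block-translation law, species words `W, W′` at `c_W·(2c′Mα₀)`), guard `2(2c′)a₀ ≤ 1`, `a₀ ≤ 1`,
`β(gVWc35(2c′)a₀)c_r ≤ ½`; the `U ≡ 1` layer `G, D_μ` ∕ `G′, D′_μ` (`β·e^{−δd}`, defects `m₀θ·e^{−δd}`); averaging species `F₂, F₂*, F₂′, F₂*′ ≤ diagK (c_F·(2c′Mα₀))`, fits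
`≤ diagK (c_F·(2c′Mα₀)·θ)`; uniform pairing fibres of `liftMap π ι` over the site lattice `Y` (`liftBlk blk ι = blkY ∘ q`); `U ≡ 1` site kernels `W_s, W_s′ ≤ β_W·e^{−δd}`,
`(QG²Q*)W_s = 1`, `(Q′G′²Q′*)W_s′ = 1`; site guard `β_W·cAmp(β, Ka₀, c_r, c_F(2c′)a₀)·c_r² ≤ ½`; `5σ ≤ δ`.  CONCLUSION: `𝔇(D_site′, D_site) ≤ siteAmp·θ·e^{−(δ−5σ)d}`.
[cite: Balaban1985BackgroundPropagators, (3.65)–(3.67) p.403 (mechanism); Thm 3.2 (3.48) p.398, (3.35) p.396, (3.60) p.402 (shapes)] -/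
theorem hasMaj_idef_vWSiteC (htri : Triangle254 g) (hd : ∀ a b : g.Site, 0 ≤ g.dist a b) {σ cr : ℝ} (hσ : 0 ≤ σ) (hcr : 0 ≤ cr) (hrow : RowSum g σ cr)
    {s : J → X ≃ X} {s' : J → X' ≃ X'} {N Nf : ℕ} {δ β m₀ θ c c' a₀ M α₀ η η' Cπ cW cF βW : ℝ} (hσδ : 5 * σ ≤ δ) (hβ : 0 ≤ β) (hm₀ : 0 ≤ m₀) (hθ : 0 ≤ θ)
    (hcomm : ∀ μ κ x, (s' μ).symm (s' κ x) = s' κ ((s' μ).symm x)) (hCπ : 0 ≤ Cπ)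
    (hconn : ∀ (f : X' → 𝔄) (b : ℝ), (∀ κ x, ‖f (s' κ x) - f x‖ ≤ b) → ∀ x₁ x₂, π x₁ = π x₂ → ‖f x₁ - f x₂‖ ≤ Cπ * b)
    (hblk : ∀ μ x', π ((s' μ ^ N) x') = s μ (π x')) (hη' : 0 < η') (hη'η : η' ≤ η) (hη1 : η ≤ 1) (hηθ : η ≤ θ) (hN : η = N * η')
    (hc : 0 ≤ c) (hc'0 : 0 < c') (hcc' : (2 + Fintype.card J) * c ≤ c') (hθ' : (1 + Fintype.card J) * Cπ * (c * M * α₀) * η' ≤ c' * M * α₀ * θ)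
    (hM : 1 ≤ M) (hα₀ : 0 < α₀) (hMα : M * α₀ ≤ a₀) (ha₀ : 0 ≤ a₀) (ha₀1 : 2 * (2 * c' * a₀) ≤ 1)
    (hq : β * (gVWc35 J (basisConst e) (2 * c') cW * a₀) * cr ≤ 1 / 2) (hcW : 0 ≤ cW) (hcF : 0 ≤ cF) (hβW : 0 ≤ βW)
    (hq2 : βW * cAmp β (gVWc35 J (basisConst e) (2 * c') cW * a₀) cr (cF * (2 * c') * a₀) * cr * cr ≤ 1 / 2)
    (hqY : ∀ p, liftBlk blk ι p = blkY (q p)) (hNf : Nf ≠ 0) (hfib : ∀ x, (fibre (liftMap π ι) x).card = Nf)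
    (hG : HasMaj (BlockNorm.ofBlocks g (liftBlk blk ι)) (BlockNorm.ofBlocks g (liftBlk blk ι)) G (fun y y' => β * Real.exp (-(δ * g.dist y y'))))
    (hD : ∀ μ, HasMaj (BlockNorm.ofBlocks g (liftBlk blk ι)) (BlockNorm.ofBlocks g (liftBlk blk ι)) (D μ) (fun y y' => β * Real.exp (-(δ * g.dist y y'))))
    (hG' : HasMaj (BlockNorm.ofBlocks g (liftBlk (blk ∘ π) ι)) (BlockNorm.ofBlocks g (liftBlk (blk ∘ π) ι)) G' (fun y y' => β * Real.exp (-(δ * g.dist y y'))))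
    (hD' : ∀ μ, HasMaj (BlockNorm.ofBlocks g (liftBlk (blk ∘ π) ι)) (BlockNorm.ofBlocks g (liftBlk (blk ∘ π) ι)) (D' μ) (fun y y' => β * Real.exp (-(δ * g.dist y y'))))
    (hDG : HasMaj (BlockNorm.ofBlocks g (liftBlk blk ι)) (BlockNorm.ofBlocks g (liftBlk (blk ∘ π) ι))
      (idef (pull (liftMap π ι)) (pull (liftMap π ι)) G' G) (fun y y' => m₀ * θ * Real.exp (-(δ * g.dist y y'))))
    (hDD : ∀ μ, HasMaj (BlockNorm.ofBlocks g (liftBlk blk ι)) (BlockNorm.ofBlocks g (liftBlk (blk ∘ π) ι))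
      (idef (pull (liftMap π ι)) (pull (liftMap π ι)) (D' μ) (D μ)) (fun y y' => m₀ * θ * Real.exp (-(δ * g.dist y y'))))
    {A' : J → X' → 𝔄} (hreg : (v1GaugeBg 𝔄 J s' η' M).Reg335 c α₀ A')
    {W : (X × ι → ℝ) →ₗ[ℝ] (X × ι → ℝ)} {W' : (X' × ι → ℝ) →ₗ[ℝ] (X' × ι → ℝ)}
    (hW : HasMaj (BlockNorm.ofBlocks g (liftBlk blk ι)) (BlockNorm.ofBlocks g (liftBlk blk ι)) W (diagK fun _ => cW * (2 * c' * M * α₀)))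
    (hW' : HasMaj (BlockNorm.ofBlocks g (liftBlk (blk ∘ π) ι)) (BlockNorm.ofBlocks g (liftBlk (blk ∘ π) ι)) W' (diagK fun _ => cW * (2 * c' * M * α₀)))
    (hDW : HasMaj (BlockNorm.ofBlocks g (liftBlk blk ι)) (BlockNorm.ofBlocks g (liftBlk (blk ∘ π) ι))
      (idef (pull (liftMap π ι)) (pull (liftMap π ι)) W' W) (diagK fun _ => cW * (2 * c' * M * α₀) * θ))
    {F : (X × ι → ℝ) →ₗ[ℝ] (Y → ℝ)} {Fs : (Y → ℝ) →ₗ[ℝ] (X × ι → ℝ)} {F' : (X' × ι → ℝ) →ₗ[ℝ] (Y → ℝ)} {Fs' : (Y → ℝ) →ₗ[ℝ] (X' × ι → ℝ)}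
    (hF : HasMaj (BlockNorm.ofBlocks g (liftBlk blk ι)) (BlockNorm.ofBlocks g blkY) F (diagK fun _ => cF * (2 * c' * M * α₀)))
    (hFs : HasMaj (BlockNorm.ofBlocks g blkY) (BlockNorm.ofBlocks g (liftBlk blk ι)) Fs (diagK fun _ => cF * (2 * c' * M * α₀)))
    (hF' : HasMaj (BlockNorm.ofBlocks g (liftBlk (blk ∘ π) ι)) (BlockNorm.ofBlocks g blkY) F' (diagK fun _ => cF * (2 * c' * M * α₀)))
    (hFs' : HasMaj (BlockNorm.ofBlocks g blkY) (BlockNorm.ofBlocks g (liftBlk (blk ∘ π) ι)) Fs' (diagK fun _ => cF * (2 * c' * M * α₀)))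
    (hDF : HasMaj (BlockNorm.ofBlocks g (liftBlk blk ι)) (BlockNorm.ofBlocks g blkY) (idef (pull (liftMap π ι)) LinearMap.id F' F)
      (diagK fun _ => cF * (2 * c' * M * α₀) * θ))
    (hDFs : HasMaj (BlockNorm.ofBlocks g blkY) (BlockNorm.ofBlocks g (liftBlk (blk ∘ π) ι)) (idef LinearMap.id (pull (liftMap π ι)) Fs' Fs)
      (diagK fun _ => cF * (2 * c' * M * α₀) * θ))
    {Ws Ws' : (Y → ℝ) →ₗ[ℝ] (Y → ℝ)}
    (hWs : HasMaj (BlockNorm.ofBlocks g blkY) (BlockNorm.ofBlocks g blkY) Ws (fun y y' => βW * Real.exp (-(δ * g.dist y y'))))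
    (hWs' : HasMaj (BlockNorm.ofBlocks g blkY) (BlockNorm.ofBlocks g blkY) Ws' (fun y y' => βW * Real.exp (-(δ * g.dist y y'))))
    (hKW : siteForm₀ q G ∘ₗ Ws = LinearMap.id) (hKW' : siteForm₀ (q ∘ liftMap π ι) G' ∘ₗ Ws' = LinearMap.id) :
    HasMaj (BlockNorm.ofBlocks g blkY) (BlockNorm.ofBlocks g blkY)
      (idef LinearMap.id LinearMap.id
        (siteInv Ws' (siteForm₀ (q ∘ liftMap π ι) G') (siteForm (q ∘ liftMap π ι) F' Fs'
          (dressedOp G' D' (vWPert (v1coefC e η' (v1fieldsOfGauge 𝔄 J s' η' A')) (v1coefA e η' (v1fieldsOfGauge 𝔄 J s' η' A')) W'))))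
        (siteInv Ws (siteForm₀ q G) (siteForm q F Fs
          (dressedOp G D (vWPert (v1coefC e η (v1fieldsOfGauge 𝔄 J s η (gavgM 𝔄 J π A'))) (v1coefA e η (v1fieldsOfGauge 𝔄 J s η (gavgM 𝔄 J π A'))) W)))))
      (fun y y' => siteAmp β (gVWc35 J (basisConst e) (2 * c') cW * a₀) cr (cF * (2 * c') * a₀) m₀ (gVWc35 J (basisConst e) (2 * c') cW) a₀
        (cF * (2 * c') * a₀) βW * θ * Real.exp (-((δ - 5 * σ) * g.dist y y'))) := by
  obtain ⟨hR0, hRa, hV, hV', hDV⟩ :=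
    vWC_letters_of_gauge e (g := g) blk π hcomm hCπ hconn hblk hη' hη'η hη1 hηθ hN hc hc'0 hcc' hθ' hM hα₀ hMα ha₀1 hcW hreg hW hW' hDW
  set K : ℝ := gVWc35 J (basisConst e) (2 * c') cW with hKdef
  have hK : 0 ≤ K := (le_gVWc35 (J := J) (basisConst_nonneg e) (by positivity : 0 < 2 * c') hcW).2.1.le
  have hθ0 : 0 ≤ θ := hθ
  have hV₁ := hV.mono fun y y' => diagK_mono (fun _ => hRa) y y'
  have hV₁' := hV'.mono fun y y' => diagK_mono (fun _ => hRa) y y'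
  have hDV₁ := hDV.mono fun y y' => diagK_mono (fun _ => mul_le_mul_of_nonneg_right hRa hθ0) y y'
  have hr : cF * (2 * c' * M * α₀) ≤ cF * (2 * c') * a₀ := by
    have : 2 * c' * M * α₀ = 2 * c' * (M * α₀) := by ring
    rw [this, mul_assoc cF]
    exact mul_le_mul_of_nonneg_left (mul_le_mul_of_nonneg_left hMα (by positivity)) hcF
  have hr0 : 0 ≤ cF * (2 * c') * a₀ := by positivity
  have hF₁ := hF.mono fun y y' => diagK_mono (fun _ => hr) y y'
  have hFs₁ := hFs.mono fun y y' => diagK_mono (fun _ => hr) y y'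
  have hF₁' := hF'.mono fun y y' => diagK_mono (fun _ => hr) y y'
  have hFs₁' := hFs'.mono fun y y' => diagK_mono (fun _ => hr) y y'
  have hDF₁ := hDF.mono fun y y' => diagK_mono (fun _ => mul_le_mul_of_nonneg_right hr hθ0) y y'
  have hDFs₁ := hDFs.mono fun y y' => diagK_mono (fun _ => mul_le_mul_of_nonneg_right hr hθ0) y y'
  exact hasMaj_idef_dressedSite htri hd hrow hσ hcr (liftBlk blk ι) blkY q (liftMap π ι) hqY hNf hfib hσδ hβ hm₀ hθ hK ha₀ hq (mul_nonneg hK ha₀) le_rfl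
    hr0 hr0 hβW hq2 hG hD hG' hD' hDG hDD hV₁ hV₁' hDV₁ hF₁ hFs₁ hF₁' hFs₁' hDF₁ hDFs₁ hWs hWs' hKW hKW'

end Config

/-! ## §3 The site-kernel family on the gauge paired instances, and the node's second conjunct BY NAME -/

section Node

variable {I J ι : Type} [Fintype J] [DecidableEq J] [Fintype ι] [DecidableEq ι] {𝔄 : Type} [NormedRing 𝔄] [NormedAlgebra ℝ 𝔄] [CompleteSpace 𝔄]
  (e : 𝔄 ≃L[ℝ] (ι → ℝ)) (g : I → B6.Geometry) (X X' Y : I → Type) [∀ i, Fintype (X i)] [∀ i, Fintype (X' i)] [∀ i, Fintype (Y i)] [∀ i, DecidableEq (X i)]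
  [∀ i, DecidableEq (X' i)] [∀ i, DecidableEq (Y i)] (blk : ∀ i, X i → (g i).Site) (blkY : ∀ i, Y i → (g i).Site) (q : ∀ i, X i × ι → Y i)
  (π : ∀ i, X' i → X i) (nsh : I → ℕ) (hL0 : ∀ i, (g i).L ≠ 0) (θ : I → ℝ)
  (G : ∀ i, (X i × ι → ℝ) →ₗ[ℝ] (X i × ι → ℝ)) (D : ∀ i, J ⊕ J → (X i × ι → ℝ) →ₗ[ℝ] (X i × ι → ℝ))
  (G' : ∀ i, (X' i × ι → ℝ) →ₗ[ℝ] (X' i × ι → ℝ)) (D' : ∀ i, J ⊕ J → (X' i × ι → ℝ) →ₗ[ℝ] (X' i × ι → ℝ))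
  (s : ∀ i, J → X i ≃ X i) (s' : ∀ i, J → X' i ≃ X' i) (Cπ : I → ℝ) (Nst Nf : I → ℕ)
  (Wc : ∀ i, (J → X' i → 𝔄) → ((X i × ι → ℝ) →ₗ[ℝ] (X i × ι → ℝ))) (Wf : ∀ i, (J → X' i → 𝔄) → ((X' i × ι → ℝ) →ₗ[ℝ] (X' i × ι → ℝ)))
  (Fc : ∀ i, (J → X' i → 𝔄) → ((X i × ι → ℝ) →ₗ[ℝ] (Y i → ℝ))) (Fsc : ∀ i, (J → X' i → 𝔄) → ((Y i → ℝ) →ₗ[ℝ] (X i × ι → ℝ)))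
  (Ff : ∀ i, (J → X' i → 𝔄) → ((X' i × ι → ℝ) →ₗ[ℝ] (Y i → ℝ))) (Fsf : ∀ i, (J → X' i → 𝔄) → ((Y i → ℝ) →ₗ[ℝ] (X' i × ι → ℝ)))
  (Ws Ws' : ∀ i, (Y i → ℝ) →ₗ[ℝ] (Y i → ℝ))

/-- THE SITE-LAYER OPS at a fine gauge field `A′` of instance `i`: the η-difference (common site lattice, identity transports) of the fine dressed site kernel at `A′`
(spacing `η′_i = η_i(L^{n_i})⁻¹`, `V′₁` coefficients at the fine triple, word `Wf i A′`, species `Ff i A′`, `Fsf i A′`, `U ≡ 1` site kernel `Ws′ i`) and the coarse one at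
the mean field's triple (`η_i`, `Wc i A′`, `Fc i A′`, `Fsc i A′`, `Ws i`). [cite: Balaban1985BackgroundPropagators, (3.65)–(3.67) p.403 (shape)] -/
def vWSiteOpsC (i : I) : (J → X' i → 𝔄) → ((Y i → ℝ) →ₗ[ℝ] (Y i → ℝ)) := fun A' =>
  idef LinearMap.id LinearMap.id
    (siteInv (Ws' i) (siteForm₀ (q i ∘ liftMap (π i) ι) (G' i)) (siteForm (q i ∘ liftMap (π i) ι) (Ff i A') (Fsf i A')
      (dressedOp (G' i) (D' i) (vWPert (v1coefC e ((g i).eta * ((g i).L ^ nsh i)⁻¹) (v1fieldsOfGauge 𝔄 J (s' i) ((g i).eta * ((g i).L ^ nsh i)⁻¹) A'))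
        (v1coefA e ((g i).eta * ((g i).L ^ nsh i)⁻¹) (v1fieldsOfGauge 𝔄 J (s' i) ((g i).eta * ((g i).L ^ nsh i)⁻¹) A')) (Wf i A')))))
    (siteInv (Ws i) (siteForm₀ (q i) (G i)) (siteForm (q i) (Fc i A') (Fsc i A')
      (dressedOp (G i) (D i) (vWPert (v1coefC e (g i).eta (v1fieldsOfGauge 𝔄 J (s i) (g i).eta (gavgM 𝔄 J (π i) A')))
        (v1coefA e (g i).eta (v1fieldsOfGauge 𝔄 J (s i) (g i).eta (gavgM 𝔄 J (π i) A'))) (Wc i A')))))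

/-- THE SITE-KERNEL FAMILY on g3's gauge paired instances: `siteKernelOf` of `vWSiteOpsC` (largest block-pair matrix entry of the η-difference). [cite: Balaban1985BackgroundPropagators, Thm 3.2 (3.48) p.398 (shape)] -/
def vWGCSiteKernel (i : I) :
    B9.SiteKernel (v1GaugeInstance 𝔄 J ι (blk i) (π i) (s i) (s' i) (nsh i) (hL0 i)).gc (v1GaugeInstance 𝔄 J ι (blk i) (π i) (s i) (s' i) (nsh i) (hL0 i)).Bf :=
  show B9.SiteKernel (opGeo (g i) (X i × ι) (liftBlk (blk i) ι)) (v1GaugeBg 𝔄 J (s' i) ((g i).eta * ((g i).L ^ nsh i)⁻¹) (g i).M) from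
    siteKernelOf (liftBlk (blk i) ι) (blkY i) (vWSiteOpsC e g X X' Y q π nsh G D G' D' s s' Wc Wf Fc Fsc Ff Fsf Ws Ws' i)

/-- **NE2⁺, SITE-KERNEL LAYER — `T4EtaRate.NE2PlusSite 4 p c₃₅` BY NAME, (3.60)-SHAPED FULL PERTURBATION LIVE, GAUGE FIELD THE DATUM** — on the SAME gauge paired
instances as F15's `ne2PlusOperator_vWGC` and with the same structural hypotheses ([B6] carriers, uniform (2.61), the `U ≡ 1` layer `G, D_μ` with uniform letters,
commuting unit shifts, `C_π(i)`-step-connected fibres with `C_π(i)η′_i ≤ C₀θ_i`, block-translation law, word species `Wc i A′`, `Wf i A′` with (3.35)-letters in the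
regime `2c₃₅M_iα₀ ≤ 1`), PLUS: averaging species `Fc, Fsc, Ff, Fsf` with block-local letters `≤ diagK (c_F·c₃₅M_iα₀)` and fits `≤ diagK (c_F·c₃₅M_iα₀·θ_i)` in the same
regime, uniform pairing fibres over the site lattices `Y i` (`liftBlk (blk i) ι = blkY i ∘ q i`), unit-scale sites (`len ≡ 1`), and the `U ≡ 1` SITE KERNELS `Ws i, Ws′ i`
with a uniform majorant `β_W·e^{−δd}` inverting `QG²Q*` ∕ `Q′G′²Q′*` — then `NE2PlusSite 4 p c₃₅ pi (vWGCSiteKernel …)` for every `p` (inside: `M₅ = 1`, `δ_site = δ − 5σ`,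
`a₀ = min a₁ a₂`, `C = siteAmp + 1`).  NOT PRINTED (no η-rate is); N15's second conjunct for a background-live family, the `U ≡ 1` site kernels displayed.
[cite: Balaban1985BackgroundPropagators, Thm 3.2 (3.48) p.398 + Thm 3.14 pp.426–427 (quantifier template); (3.35) p.396, (3.60) p.402, (3.65)–(3.67) p.403 (shapes, mechanism)] -/
theorem ne2PlusSite_vWGC (c35 : ℝ) (hc35 : 0 < c35) (p : ℝ)
    (htri : ∀ i, Triangle254 (g i)) (hd : ∀ i (a b : (g i).Site), 0 ≤ (g i).dist a b) {σ cr : ℝ} (hσ : 0 ≤ σ) (hcr : 0 ≤ cr)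
    (hrow : ∀ i, RowSum (g i) σ cr) (hη : ∀ i, 0 < (g i).eta) (hη1 : ∀ i, (g i).eta ≤ 1) (hηθ : ∀ i, (g i).eta ≤ θ i) (hL : ∀ i, 1 ≤ (g i).L)
    (hlen : ∀ i y, (g i).len y = 1) {δ β m₀ γ cW cF βW : ℝ} (hσδ : 5 * σ < δ) (hβ : 0 ≤ β) (hm₀ : 0 ≤ m₀) (hγ : 0 < γ)
    (hθγ : ∀ i y, θ i ≤ rateWeight (g i) γ y)
    (hcomm : ∀ i μ κ x, (s' i μ).symm (s' i κ x) = s' i κ ((s' i μ).symm x)) (hCπ : ∀ i, 0 ≤ Cπ i)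
    (hconn : ∀ i (f : X' i → 𝔄) (b : ℝ), (∀ κ x, ‖f (s' i κ x) - f x‖ ≤ b) → ∀ x₁ x₂, π i x₁ = π i x₂ → ‖f x₁ - f x₂‖ ≤ Cπ i * b)
    {C₀ : ℝ} (hC₀ : 0 ≤ C₀) (hCθ : ∀ i, Cπ i * ((g i).eta * ((g i).L ^ nsh i)⁻¹) ≤ C₀ * θ i) (hcW : 0 ≤ cW) (hcF : 0 ≤ cF) (hβW : 0 ≤ βW)
    (hblk : ∀ i μ x', π i ((s' i μ ^ Nst i) x') = s i μ (π i x')) (hN : ∀ i, (g i).eta = Nst i * ((g i).eta * ((g i).L ^ nsh i)⁻¹))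
    (hqY : ∀ i pt, liftBlk (blk i) ι pt = blkY i (q i pt)) (hNf : ∀ i, Nf i ≠ 0) (hfib : ∀ i x, (fibre (liftMap (π i) ι) x).card = Nf i)
    (hWc : ∀ i (α₀ : ℝ) A', 0 < α₀ → 2 * (c35 * ((g i).M * α₀)) ≤ 1 → (v1GaugeBg 𝔄 J (s' i) ((g i).eta * ((g i).L ^ nsh i)⁻¹) (g i).M).Reg335 c35 α₀ A' →
      HasMaj (BlockNorm.ofBlocks (g i) (liftBlk (blk i) ι)) (BlockNorm.ofBlocks (g i) (liftBlk (blk i) ι)) (Wc i A') (diagK fun _ => cW * (c35 * (g i).M * α₀)))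
    (hWf : ∀ i (α₀ : ℝ) A', 0 < α₀ → 2 * (c35 * ((g i).M * α₀)) ≤ 1 → (v1GaugeBg 𝔄 J (s' i) ((g i).eta * ((g i).L ^ nsh i)⁻¹) (g i).M).Reg335 c35 α₀ A' →
      HasMaj (BlockNorm.ofBlocks (g i) (liftBlk (blk i ∘ π i) ι)) (BlockNorm.ofBlocks (g i) (liftBlk (blk i ∘ π i) ι)) (Wf i A')
        (diagK fun _ => cW * (c35 * (g i).M * α₀)))
    (hDW : ∀ i (α₀ : ℝ) A', 0 < α₀ → 2 * (c35 * ((g i).M * α₀)) ≤ 1 → (v1GaugeBg 𝔄 J (s' i) ((g i).eta * ((g i).L ^ nsh i)⁻¹) (g i).M).Reg335 c35 α₀ A' →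
      HasMaj (BlockNorm.ofBlocks (g i) (liftBlk (blk i) ι)) (BlockNorm.ofBlocks (g i) (liftBlk (blk i ∘ π i) ι))
        (idef (pull (liftMap (π i) ι)) (pull (liftMap (π i) ι)) (Wf i A') (Wc i A')) (diagK fun _ => cW * (c35 * (g i).M * α₀) * θ i))
    (hFc : ∀ i (α₀ : ℝ) A', 0 < α₀ → 2 * (c35 * ((g i).M * α₀)) ≤ 1 → (v1GaugeBg 𝔄 J (s' i) ((g i).eta * ((g i).L ^ nsh i)⁻¹) (g i).M).Reg335 c35 α₀ A' →
      HasMaj (BlockNorm.ofBlocks (g i) (liftBlk (blk i) ι)) (BlockNorm.ofBlocks (g i) (blkY i)) (Fc i A') (diagK fun _ => cF * (c35 * (g i).M * α₀)))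
    (hFsc : ∀ i (α₀ : ℝ) A', 0 < α₀ → 2 * (c35 * ((g i).M * α₀)) ≤ 1 → (v1GaugeBg 𝔄 J (s' i) ((g i).eta * ((g i).L ^ nsh i)⁻¹) (g i).M).Reg335 c35 α₀ A' →
      HasMaj (BlockNorm.ofBlocks (g i) (blkY i)) (BlockNorm.ofBlocks (g i) (liftBlk (blk i) ι)) (Fsc i A') (diagK fun _ => cF * (c35 * (g i).M * α₀)))
    (hFf : ∀ i (α₀ : ℝ) A', 0 < α₀ → 2 * (c35 * ((g i).M * α₀)) ≤ 1 → (v1GaugeBg 𝔄 J (s' i) ((g i).eta * ((g i).L ^ nsh i)⁻¹) (g i).M).Reg335 c35 α₀ A' →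
      HasMaj (BlockNorm.ofBlocks (g i) (liftBlk (blk i ∘ π i) ι)) (BlockNorm.ofBlocks (g i) (blkY i)) (Ff i A') (diagK fun _ => cF * (c35 * (g i).M * α₀)))
    (hFsf : ∀ i (α₀ : ℝ) A', 0 < α₀ → 2 * (c35 * ((g i).M * α₀)) ≤ 1 → (v1GaugeBg 𝔄 J (s' i) ((g i).eta * ((g i).L ^ nsh i)⁻¹) (g i).M).Reg335 c35 α₀ A' →
      HasMaj (BlockNorm.ofBlocks (g i) (blkY i)) (BlockNorm.ofBlocks (g i) (liftBlk (blk i ∘ π i) ι)) (Fsf i A') (diagK fun _ => cF * (c35 * (g i).M * α₀)))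
    (hDF : ∀ i (α₀ : ℝ) A', 0 < α₀ → 2 * (c35 * ((g i).M * α₀)) ≤ 1 → (v1GaugeBg 𝔄 J (s' i) ((g i).eta * ((g i).L ^ nsh i)⁻¹) (g i).M).Reg335 c35 α₀ A' →
      HasMaj (BlockNorm.ofBlocks (g i) (liftBlk (blk i) ι)) (BlockNorm.ofBlocks (g i) (blkY i))
        (idef (pull (liftMap (π i) ι)) LinearMap.id (Ff i A') (Fc i A')) (diagK fun _ => cF * (c35 * (g i).M * α₀) * θ i))
    (hDFs : ∀ i (α₀ : ℝ) A', 0 < α₀ → 2 * (c35 * ((g i).M * α₀)) ≤ 1 → (v1GaugeBg 𝔄 J (s' i) ((g i).eta * ((g i).L ^ nsh i)⁻¹) (g i).M).Reg335 c35 α₀ A' →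
      HasMaj (BlockNorm.ofBlocks (g i) (blkY i)) (BlockNorm.ofBlocks (g i) (liftBlk (blk i ∘ π i) ι))
        (idef LinearMap.id (pull (liftMap (π i) ι)) (Fsf i A') (Fsc i A')) (diagK fun _ => cF * (c35 * (g i).M * α₀) * θ i))
    (hG : ∀ i, HasMaj (BlockNorm.ofBlocks (g i) (liftBlk (blk i) ι)) (BlockNorm.ofBlocks (g i) (liftBlk (blk i) ι)) (G i)
      (fun y y' => β * Real.exp (-(δ * (g i).dist y y'))))
    (hD : ∀ i μ, HasMaj (BlockNorm.ofBlocks (g i) (liftBlk (blk i) ι)) (BlockNorm.ofBlocks (g i) (liftBlk (blk i) ι)) (D i μ)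
      (fun y y' => β * Real.exp (-(δ * (g i).dist y y'))))
    (hG' : ∀ i, HasMaj (BlockNorm.ofBlocks (g i) (liftBlk (blk i ∘ π i) ι)) (BlockNorm.ofBlocks (g i) (liftBlk (blk i ∘ π i) ι)) (G' i)
      (fun y y' => β * Real.exp (-(δ * (g i).dist y y'))))
    (hD' : ∀ i μ, HasMaj (BlockNorm.ofBlocks (g i) (liftBlk (blk i ∘ π i) ι)) (BlockNorm.ofBlocks (g i) (liftBlk (blk i ∘ π i) ι)) (D' i μ)
      (fun y y' => β * Real.exp (-(δ * (g i).dist y y'))))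
    (hDG : ∀ i, HasMaj (BlockNorm.ofBlocks (g i) (liftBlk (blk i) ι)) (BlockNorm.ofBlocks (g i) (liftBlk (blk i ∘ π i) ι))
      (idef (pull (liftMap (π i) ι)) (pull (liftMap (π i) ι)) (G' i) (G i)) (fun y y' => m₀ * θ i * Real.exp (-(δ * (g i).dist y y'))))
    (hDD : ∀ i μ, HasMaj (BlockNorm.ofBlocks (g i) (liftBlk (blk i) ι)) (BlockNorm.ofBlocks (g i) (liftBlk (blk i ∘ π i) ι))
      (idef (pull (liftMap (π i) ι)) (pull (liftMap (π i) ι)) (D' i μ) (D i μ)) (fun y y' => m₀ * θ i * Real.exp (-(δ * (g i).dist y y'))))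
    (hWs : ∀ i, HasMaj (BlockNorm.ofBlocks (g i) (blkY i)) (BlockNorm.ofBlocks (g i) (blkY i)) (Ws i) (fun y y' => βW * Real.exp (-(δ * (g i).dist y y'))))
    (hWs' : ∀ i, HasMaj (BlockNorm.ofBlocks (g i) (blkY i)) (BlockNorm.ofBlocks (g i) (blkY i)) (Ws' i) (fun y y' => βW * Real.exp (-(δ * (g i).dist y y'))))
    (hKW : ∀ i, siteForm₀ (q i) (G i) ∘ₗ Ws i = LinearMap.id) (hKW' : ∀ i, siteForm₀ (q i ∘ liftMap (π i) ι) (G' i) ∘ₗ Ws' i = LinearMap.id) :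
    NE2PlusSite 4 p c35 (fun i => v1GaugeInstance 𝔄 J ι (blk i) (π i) (s i) (s' i) (nsh i) (hL0 i))
      (vWGCSiteKernel e g X X' Y blk blkY q π nsh hL0 G D G' D' s s' Wc Wf Fc Fsc Ff Fsf Ws Ws') := by
  have hJ0 : (0 : ℝ) ≤ Fintype.card J := Nat.cast_nonneg _
  set c' : ℝ := (2 + Fintype.card J) * (1 + C₀) * c35 with hc'
  have hc'pos : 0 < c' := by positivity
  have hc35c' : c35 ≤ 2 * c' := by
    rw [hc']
    have h1 : (1 : ℝ) ≤ 2 * ((2 + Fintype.card J) * (1 + C₀)) := by nlinarith [mul_nonneg hJ0 hC₀]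
    nlinarith
  have h2c'pos : 0 < 2 * c' := by positivity
  obtain ⟨hcg, hgpos, _⟩ := le_gVWc35 (J := J) (basisConst_nonneg e) h2c'pos hcW
  have hP : 0 ≤ cLin β (gVWc35 J (basisConst e) (2 * c') cW) cr (cF * (2 * c')) := cLin_nonneg hβ hgpos.le hcr (by positivity)
  obtain ⟨a₀, ha₀, ha₀le, hq, ha₀1, hq2P⟩ := site_thresholds hβ hcr hgpos hcg hc'pos hP hβW
  have hq2 : βW * cAmp β (gVWc35 J (basisConst e) (2 * c') cW * a₀) cr (cF * (2 * c') * a₀) * cr * cr ≤ 1 / 2 := by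
    have hle := cAmp_le_lin (β := β) (K := gVWc35 J (basisConst e) (2 * c') cW) (cr := cr) (rK := cF * (2 * c')) hβ hgpos.le hcr (by positivity)
      ha₀.le ha₀le hq
    have h1 : βW * cAmp β (gVWc35 J (basisConst e) (2 * c') cW * a₀) cr (cF * (2 * c') * a₀) * cr * cr ≤
        βW * (a₀ * cLin β (gVWc35 J (basisConst e) (2 * c') cW) cr (cF * (2 * c'))) * cr * cr :=
      mul_le_mul_of_nonneg_right (mul_le_mul_of_nonneg_right (mul_le_mul_of_nonneg_left hle hβW) hcr) hcr
    exact h1.trans hq2P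
  have hqlt : β * (gVWc35 J (basisConst e) (2 * c') cW * a₀) * cr < 1 := by linarith
  have hq2lt : βW * cAmp β (gVWc35 J (basisConst e) (2 * c') cW * a₀) cr (cF * (2 * c') * a₀) * cr * cr < 1 := by linarith
  have hC : 0 ≤ siteAmp β (gVWc35 J (basisConst e) (2 * c') cW * a₀) cr (cF * (2 * c') * a₀) m₀ (gVWc35 J (basisConst e) (2 * c') cW) a₀
      (cF * (2 * c') * a₀) βW := siteAmp_nonneg hβ hcr (by positivity) hm₀ hgpos.le ha₀.le (by positivity) hβW hqlt hq2lt
  generalize hCdef : siteAmp β (gVWc35 J (basisConst e) (2 * c') cW * a₀) cr (cF * (2 * c') * a₀) m₀ (gVWc35 J (basisConst e) (2 * c') cW) a₀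
      (cF * (2 * c') * a₀) βW = C at hC
  refine ⟨1, δ - 5 * σ, a₀, C + 1, γ, one_pos, by linarith, ha₀, by linarith, hγ, fun i hM α₀ hα₀ hMα A' hreg => ?_⟩
  have hM' : 1 ≤ (g i).M := hM; have hMα' : (g i).M * α₀ ≤ a₀ := hMα; have hM0 : 0 ≤ (g i).M := zero_le_one.trans hM'
  have hLpos : 0 < (g i).L := lt_of_lt_of_le one_pos (hL i)
  have hη'pos : 0 < (g i).eta * ((g i).L ^ nsh i)⁻¹ := mul_pos (hη i) (inv_pos.2 (pow_pos hLpos _))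
  have hη'η : (g i).eta * ((g i).L ^ nsh i)⁻¹ ≤ (g i).eta := by
    have h1 : ((g i).L ^ nsh i)⁻¹ ≤ 1 := inv_le_one_of_one_le₀ (one_le_pow₀ (hL i))
    calc (g i).eta * ((g i).L ^ nsh i)⁻¹ ≤ (g i).eta * 1 := mul_le_mul_of_nonneg_left h1 (hη i).le
      _ = (g i).eta := mul_one _
  have hθ0 : 0 ≤ θ i := (hη i).le.trans (hηθ i)
  have hcc' : (2 + Fintype.card J) * c35 ≤ c' := by
    rw [hc']
    have h0 : 0 ≤ (2 + Fintype.card J) * c35 := by positivity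
    nlinarith [mul_nonneg hC₀ h0]
  have hθ' : (1 + Fintype.card J) * Cπ i * (c35 * (g i).M * α₀) * ((g i).eta * ((g i).L ^ nsh i)⁻¹) ≤ c' * (g i).M * α₀ * θ i := by
    have h0 : 0 ≤ (1 + Fintype.card J) * (c35 * (g i).M * α₀) := by positivity
    have hMα0 : 0 ≤ (g i).M * α₀ := mul_nonneg hM0 hα₀.le
    have hcoef : (1 + Fintype.card J) * C₀ * c35 ≤ c' := by
      rw [hc']; nlinarith [mul_nonneg hC₀ hJ0, hc35.le, mul_nonneg (mul_nonneg hC₀ hJ0) hc35.le, mul_nonneg hJ0 hc35.le, mul_nonneg hC₀ hc35.le]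
    calc (1 + Fintype.card J) * Cπ i * (c35 * (g i).M * α₀) * ((g i).eta * ((g i).L ^ nsh i)⁻¹)
        = (1 + Fintype.card J) * (c35 * (g i).M * α₀) * (Cπ i * ((g i).eta * ((g i).L ^ nsh i)⁻¹)) := by ring
      _ ≤ (1 + Fintype.card J) * (c35 * (g i).M * α₀) * (C₀ * θ i) := mul_le_mul_of_nonneg_left (hCθ i) h0
      _ = ((1 + Fintype.card J) * C₀ * c35) * ((g i).M * α₀) * θ i := by ring
      _ ≤ c' * ((g i).M * α₀) * θ i := mul_le_mul_of_nonneg_right (mul_le_mul_of_nonneg_right hcoef hMα0) hθ0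
      _ = c' * (g i).M * α₀ * θ i := by ring
  have hregA : (v1GaugeBg 𝔄 J (s' i) ((g i).eta * ((g i).L ^ nsh i)⁻¹) (g i).M).Reg335 c35 α₀ A' := hreg
  have hmono : c35 * (g i).M * α₀ ≤ 2 * c' * (g i).M * α₀ := mul_le_mul_of_nonneg_right (mul_le_mul_of_nonneg_right hc35c' hM0) hα₀.le
  have hmW : cW * (c35 * (g i).M * α₀) ≤ cW * (2 * c' * (g i).M * α₀) := mul_le_mul_of_nonneg_left hmono hcW
  have hmF : cF * (c35 * (g i).M * α₀) ≤ cF * (2 * c' * (g i).M * α₀) := mul_le_mul_of_nonneg_left hmono hcF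
  have hsm : 2 * (c35 * ((g i).M * α₀)) ≤ 1 :=
    (mul_le_mul_of_nonneg_left ((mul_le_mul_of_nonneg_left hMα' hc35.le).trans (mul_le_mul_of_nonneg_right hc35c' ha₀.le)) zero_le_two).trans ha₀1
  have hWc' := (hWc i α₀ A' hα₀ hsm hregA).mono fun y y' => diagK_mono (fun _ => hmW) y y'
  have hWf' := (hWf i α₀ A' hα₀ hsm hregA).mono fun y y' => diagK_mono (fun _ => hmW) y y'
  have hDW' := (hDW i α₀ A' hα₀ hsm hregA).mono fun y y' => diagK_mono (fun _ => mul_le_mul_of_nonneg_right hmW hθ0) y y'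
  have hFc' := (hFc i α₀ A' hα₀ hsm hregA).mono fun y y' => diagK_mono (fun _ => hmF) y y'
  have hFsc' := (hFsc i α₀ A' hα₀ hsm hregA).mono fun y y' => diagK_mono (fun _ => hmF) y y'
  have hFf' := (hFf i α₀ A' hα₀ hsm hregA).mono fun y y' => diagK_mono (fun _ => hmF) y y'
  have hFsf' := (hFsf i α₀ A' hα₀ hsm hregA).mono fun y y' => diagK_mono (fun _ => hmF) y y'
  have hDF' := (hDF i α₀ A' hα₀ hsm hregA).mono fun y y' => diagK_mono (fun _ => mul_le_mul_of_nonneg_right hmF hθ0) y y'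
  have hDFs' := (hDFs i α₀ A' hα₀ hsm hregA).mono fun y y' => diagK_mono (fun _ => mul_le_mul_of_nonneg_right hmF hθ0) y y'
  have key := hasMaj_idef_vWSiteC e (blk i) (blkY i) (q i) (π i) (htri i) (hd i) hσ hcr (hrow i) hσδ.le hβ hm₀ hθ0 (hcomm i) (hCπ i) (hconn i) (hblk i)
    hη'pos hη'η (hη1 i) (hηθ i) (hN i) hc35.le hc'pos hcc' hθ' hM' hα₀ hMα' ha₀.le ha₀1 hq hcW hcF hβW hq2 (hqY i) (hNf i) (hfib i) (hG i) (hD i) (hG' i)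
    (hD' i) (hDG i) (hDD i) hregA hWc' hWf' hDW' hFc' hFsc' hFf' hFsf' hDF' hDFs' (hWs i) (hWs' i) (hKW i) (hKW' i)
  rw [hCdef] at key
  have key' : HasMaj (BlockNorm.ofBlocks (g i) (blkY i)) (BlockNorm.ofBlocks (g i) (blkY i))
      (vWSiteOpsC e g X X' Y q π nsh G D G' D' s s' Wc Wf Fc Fsc Ff Fsf Ws Ws' i A')
      (fun y y' => C * Real.exp (-((δ - 5 * σ) * (g i).dist y y')) * rateWeight (g i) γ y') := by
    refine key.mono fun y y' => ?_
    calc C * θ i * Real.exp (-((δ - 5 * σ) * (g i).dist y y'))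
        = C * Real.exp (-((δ - 5 * σ) * (g i).dist y y')) * θ i := by ring
      _ ≤ C * Real.exp (-((δ - 5 * σ) * (g i).dist y y')) * rateWeight (g i) γ y' :=
          mul_le_mul_of_nonneg_left (hθγ i y') (mul_nonneg hC (Real.exp_nonneg _))
  have hcC : ∀ y y' : (g i).Site, C ≤ (C + 1) * (g i).len y ^ (-p) * (g i).len y' ^ (-((4 : ℕ) : ℝ)) := fun y y' => by
    rw [hlen i y, hlen i y', Real.one_rpow, Real.one_rpow, mul_one, mul_one]
    linarith
  have hC1 : 0 ≤ C + 1 := by linarith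
  have fin := etaRateIneqSite_opGeo_of_hasMaj_rateWeight (B := v1GaugeBg 𝔄 J (s' i) ((g i).eta * ((g i).L ^ nsh i)⁻¹) (g i).M) (d := 4) (p := p)
    (liftBlk (blk i) ι) (blkY i) (hη i) hLpos hC1 hC hcC (vWSiteOpsC e g X X' Y q π nsh G D G' D' s s' Wc Wf Fc Fsc Ff Fsf Ws Ws' i) A' key'
  intro y y'
  exact fin y y'

end Node

end Summit.QuantumFields.YangMills.BalabanUVNodes.N15.SiteLayer

end
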